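/-
Copyright (c) 2026 the pub-hodgecm-mathlib formalisation cell (harness21).  Prover seat hodgecm-mathlib-K2Liu-p07 (g3), Track B «K2-LIT»,
#184♮ = hLiu418 = `stmt-HodgeConjecture-24832`; #42S payer road, organ S1 (local Siegel–Weil spanning), ROAD W, letter (q4′) of file F7r
(LEAD F0P6-plan (g14) BATCH #8 (3): «`exists_unit_hilbertSymbol_neg_of_ramified` = p07»; consumer: the S1 assembly of K2Liu-p06 (g4)).
-/
import Literature.NumberTheory.QuadraticForms.HilbertSymbolAtUnramifiedPlace     -- ★ `count_relIdealNorm_eq_of_finitePlacesOver_eq_singleton`, places of `K(√θ)/K`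
import Literature.NumberTheory.NumberFields.CMFieldHasseNorm                    -- ★ the CM norm form `N(x + yα) = x² − θy²`
import Literature.NumberTheory.Automorphic.UnitaryGroupNonsplitPlace            -- ★ `PlacesOver.subsingleton_of_smul_eq`
import Literature.NumberTheory.GelbartRogawski1991.UnitaryDualPairThetaKernelCM   -- ★ `imagUnit`, `imagUnitSq` (the letters of F7r)
import HarnessLib

/-!
# Crux `HLiu418`, #42S organ S1, ROAD W, letter (q4′): AT A RAMIFIED NON-SPLIT PLACE A GLOBAL `v`-UNIT WHICH IS A LOCAL NON-NORM EXISTS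

Cell `hodgecm-mathlib`, crux item hLiu418 = `stmt-HodgeConjecture-24832`; squad K2 ∕ K2Liu; LEAD F0P6-plan (g14), organ lead K2Liu-p06 (g4);
prover K2Liu-p07 (g3).  THEOREMS ONLY (no `def`, no instance, no notation, no named-fact hypothesis, no `sorry`); lane
`--supports stmt-HodgeConjecture-24832 --as helper`.

WHY.  The ramified witness of ROAD W (★ `K2LiuLocalSWRamifiedRelativeSign`, ★ `K2LiuLocalSWRamifiedRankOneSign`) is `f₀ = F + F ∘ Ad(d_a)` with
`a ∈ L⁺` a GLOBAL element which is a `v`-adic UNIT (so that `Ad(d_a)` permutes the coordinate boxes) and a local NON-norm from `L_w`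
(`(δ², a)_v = −1`, so that `R(V′⁻_v) = D_a R(V′⁺_v)`).  The assembly (K2Liu-p06 (g4)) holds a global `c` with `(δ², c)_v = −1` of arbitrary
`v`-order (K2Liu-p03 (g7)'s `c₁`); this file trades it for a unit: at a place `v` of `K` NON-SPLIT and RAMIFIED in the quadratic extension
`E = K(α)`, `α² = θ`, the inertia degree is `f(w∣v) = 1` (`#{w ∣ v}·e·f = 2`, `e ≠ 1`), so `ord_v N_{E∕K}(z) = ord_w z` for every `z ∈ Eˣ`
(★ `count_relIdealNorm_eq_of_finitePlacesOver_eq_singleton`) and the norm of a `w`-uniformiser is a `v`-UNIFORMISER which is a local norm;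
dividing `c` by the right power of it gives the unit.  (At an unramified place no such unit exists — ★ `hilbertSymbol_unit_eq_one_of_isUnramifiedIn` —
which is why the inert witness is the parity oscillation of file F7 instead.)

CONTENTS.  §1 (any quadratic extension `E∕K` of number fields): `inertiaDeg_eq_one_of_not_isUnramifiedIn`, `log_valuation_norm_eq_of_not_isUnramifiedIn`
(`ord_v N(z) = ord_w z`), `exists_valuation_norm_eq_exp_neg_one` (a norm which is a `v`-uniformiser).  §2 (`L` CM, `K = L⁺`, `E = L`):
`algebraMap_norm_eq_mul_complexConj` (`N(e) = e·ē`), `hilbertSymbol_norm_eq_one` (`(θ, N e)_v = 1`), and the head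
**`exists_unit_hilbertSymbol_neg_of_ramified`**: `∃ a : L⁺, ord_v a = 0 ∧ (θ, a)_v = −1`.
References: [Omeara1963] §63B (63:10), §63C (63:16), §65A; [NeukirchANT1999] Ch. III (1.6)–(1.7), Ch. V (1.2); [CasselsFrohlichANT1967] Ch. VII Prop. 1.2;
[MilneCM2006] Ch. II §9 (proof of Lemma 9.14).
HONEST LABEL.  Count-neutral helper: `HC_CM` is proved only modulo the 7 printed citations (2 remaining named inputs: hLiu418 = `stmt-HodgeConjecture-24832`,
h413 = `stmt-HodgeConjecture-24833`) until rung 0 closes.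
-/

set_option autoImplicit false
set_option linter.dupNamespace false -- the mandated namespace repeats `HodgeConjecture.HodgeConjecture`

noncomputable section

open NumberField IsDedekindDomain
open Literature.NumberTheory.QuadraticForms Literature.NumberTheory.GaloisRepresentations Literature.NumberTheory.NumberFields
open scoped nonZeroDivisors

namespace Summit.HodgeConjecture.HodgeConjecture.Cruxes.HLiu418.K2LiuRamifiedUnitNonNorm

/-! ## §1 A ramified non-split place of a quadratic extension: `f = 1`, `ord_v N(z) = ord_w z`, a norm uniformiser -/

section Quadratic

variable {K : Type} [Field K] [NumberField K] {E : Type} [Field E] [NumberField E] [Algebra K E] [Algebra.IsQuadraticExtension K E]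

/-- **`f(w∣v) = 1` at a ramified place with a single place `w` above it** (`#{w ∣ v}·e·f = 2` with `e ≠ 1`).
[cite: NeukirchANT1999, Ch. V §1 (1.2)] [cite: Omeara1963, §65A] -/
theorem inertiaDeg_eq_one_of_not_isUnramifiedIn {v : HeightOneSpectrum (𝓞 K)} (hram : ¬ Algebra.IsUnramifiedIn (𝓞 E) v.asIdeal)
    {w : HeightOneSpectrum (𝓞 E)} (hw : finitePlacesOver E v = {w}) : w.asIdeal.inertiaDeg (𝓞 K) = 1 := by
  haveI : v.asIdeal.IsMaximal := v.isMaximal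
  haveI : IsGaloisGroup (E ≃ₐ[K] E) (𝓞 K) (𝓞 E) := IsGaloisGroup.of_isFractionRing _ _ _ K E
  have hwv : w.under (𝓞 K) = v := by
    have hmem : w ∈ finitePlacesOver E v := by rw [hw]; exact Set.mem_singleton w
    exact hmem
  haveI : w.asIdeal.LiesOver v.asIdeal := ⟨by rw [← hwv]; rfl⟩
  have he : v.asIdeal.ramificationIdxIn (𝓞 E) ≠ 1 := by
    intro h1
    apply hram
    intro P hP hPover
    haveI := hP
    haveI := hPover
    haveI : P.IsMaximal := Ideal.IsMaximal.of_liesOver_isMaximal P v.asIdeal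
    apply Ideal.ramificationIdx_eq_one_iff.mp
    rw [← Ideal.ramificationIdxIn_eq_ramificationIdx v.asIdeal P (E ≃ₐ[K] E)]
    exact h1
  have h1 : (finitePlacesOver E v).ncard = 1 := by rw [hw, Set.ncard_singleton]
  have h := QuadraticExtension.ncard_finitePlacesOver_mul_eq_two (E := E) v
  rw [h1, one_mul] at h
  have hdvd : v.asIdeal.ramificationIdxIn (𝓞 E) ∣ 2 := ⟨_, h.symm⟩
  rcases (Nat.dvd_prime Nat.prime_two).1 hdvd with h1' | h2
  · exact absurd h1' he
  · rw [h2] at h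
    rw [← Ideal.inertiaDegIn_eq_inertiaDeg v.asIdeal w.asIdeal (E ≃ₐ[K] E)]
    omega

/-- **`ord_v N_{E∕K}(z) = ord_w z`** at a ramified place with a single place `w` above it (`ord_v N(𝔄) = f·ord_w 𝔄` with `f = 1`).
[cite: NeukirchANT1999, Ch. III §1 (1.6)–(1.7)] -/
theorem log_valuation_norm_eq_of_not_isUnramifiedIn {v : HeightOneSpectrum (𝓞 K)} (hram : ¬ Algebra.IsUnramifiedIn (𝓞 E) v.asIdeal)
    {w : HeightOneSpectrum (𝓞 E)} (hw : finitePlacesOver E v = {w}) (z : Eˣ) :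
    WithZero.log (v.valuation K (Algebra.norm K (z : E))) = WithZero.log (w.valuation E (z : E)) := by
  have hf := inertiaDeg_eq_one_of_not_isUnramifiedIn hram hw
  have hc := count_relIdealNorm_eq_of_finitePlacesOver_eq_singleton hw (toPrincipalIdeal (𝓞 E) E z)
  rw [relIdealNorm_toPrincipalIdeal, count_toPrincipalIdeal, count_toPrincipalIdeal, hf, Nat.cast_one, one_mul] at hc
  simpa only [Units.coe_map, MonoidHom.coe_coe, neg_inj] using hc

/-- **the norm of a `w`-uniformiser is a `v`-uniformiser** at a ramified place with a single place `w` above it: there is `z ∈ Eˣ` with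
`ord_v N_{E∕K}(z) = 1`. [cite: NeukirchANT1999, Ch. V §1 (1.2)] [cite: Omeara1963, §65A] -/
theorem exists_valuation_norm_eq_exp_neg_one {v : HeightOneSpectrum (𝓞 K)} (hram : ¬ Algebra.IsUnramifiedIn (𝓞 E) v.asIdeal)
    {w : HeightOneSpectrum (𝓞 E)} (hw : finitePlacesOver E v = {w}) :
    ∃ z : E, z ≠ 0 ∧ v.valuation K (Algebra.norm K z) = WithZero.exp (-1 : ℤ) := by
  obtain ⟨π, hπ⟩ := w.valuation_exists_uniformizer E
  have hπ0 : π ≠ 0 := by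
    rintro rfl
    rw [map_zero] at hπ
    exact WithZero.zero_ne_coe hπ
  refine ⟨π, hπ0, ?_⟩
  have h := log_valuation_norm_eq_of_not_isUnramifiedIn hram hw (Units.mk0 π hπ0)
  rw [Units.val_mk0, hπ, WithZero.log_exp] at h
  have hN0 : v.valuation K (Algebra.norm K π) ≠ 0 := (Valuation.ne_zero_iff _).2 (Algebra.norm_ne_zero_iff.2 hπ0)
  rw [← WithZero.exp_log hN0, h]

end Quadratic

/-! ## §2 The CM case: a global `v`-unit local non-norm at a ramified non-split place -/

section CM

variable {L : Type} [Field L] [NumberField L] [IsCMField L]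

/-- `N_{L∕L⁺}(e) = e · ē`. [cite: MilneCM2006, Ch. II §9 (proof of Lemma 9.14)] -/
theorem algebraMap_norm_eq_mul_complexConj (e : L) :
    algebraMap (maximalRealSubfield L) L (Algebra.norm (maximalRealSubfield L) e) = e * IsCMField.complexConj L e := by
  classical
  rw [Algebra.norm_eq_prod_automorphisms]
  have hne : (IsCMField.complexConj L : L ≃ₐ[maximalRealSubfield L] L) ≠ 1 := IsCMField.complexConj_ne_one L
  have huniv : (Finset.univ : Finset (L ≃ₐ[maximalRealSubfield L] L)) = {1, IsCMField.complexConj L} := by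
    ext τ
    simp only [Finset.mem_univ, Finset.mem_insert, Finset.mem_singleton, true_iff]
    exact QuadraticExtension.algEquiv_eq_one_or_eq hne τ
  rw [huniv, Finset.prod_pair hne.symm, AlgEquiv.one_apply]

/-- **global norms are local norms**: `(θ, N_{L∕L⁺}(e))_v = 1` for `e ∈ Lˣ` at every finite place `v` of `L⁺` (`L = L⁺(α)`, `α² = θ`, `ᾱ = −α`:
`N(x + yα) = x² − θy²`). [cite: Omeara1963, §63B (63:10)] [cite: MilneCM2006, Ch. II §9 (proof of Lemma 9.14)] -/
theorem hilbertSymbol_norm_eq_one {α : L} (hα : IsCMField.complexConj L α = -α) (hα0 : α ≠ 0) {θ : maximalRealSubfield L}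
    (hθ : α ^ 2 = algebraMap (maximalRealSubfield L) L θ) (v : HeightOneSpectrum (𝓞 (maximalRealSubfield L))) {e : L} (he : e ≠ 0) :
    hilbertSymbol (v.adicCompletion (maximalRealSubfield L)) (algebraMap _ (v.adicCompletion (maximalRealSubfield L)) θ)
      (algebraMap _ (v.adicCompletion (maximalRealSubfield L)) (Algebra.norm (maximalRealSubfield L) e)) = 1 := by
  set Kv := v.adicCompletion (maximalRealSubfield L)
  haveI : CharZero Kv := charZero_of_injective_algebraMap (algebraMap (maximalRealSubfield L) Kv).injective
  haveI : NeZero (2 : Kv) := ⟨two_ne_zero⟩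
  obtain ⟨x, y, hxy⟩ := IsCMField.exists_eq_add_mul hα hα0 e
  have hN : Algebra.norm (maximalRealSubfield L) e = x ^ 2 - θ * y ^ 2 := by
    apply (algebraMap (maximalRealSubfield L) L).injective
    rw [algebraMap_norm_eq_mul_complexConj, hxy, IsCMField.add_mul_mul_complexConj_add_mul hα hθ]
  have hθ0 : (θ : maximalRealSubfield L) ≠ 0 := fun h => by
    rw [h, map_zero, sq_eq_zero_iff] at hθ
    exact hα0 hθ
  have hN0 : Algebra.norm (maximalRealSubfield L) e ≠ 0 := Algebra.norm_ne_zero_iff.2 he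
  rw [hilbertSymbol_eq_one_iff_exists_norm ((map_ne_zero _).2 hθ0) ((map_ne_zero _).2 hN0)]
  exact ⟨algebraMap _ Kv x, algebraMap _ Kv y, by rw [hN, map_sub, map_mul, map_pow, map_pow]⟩

/-- **(q4′) A GLOBAL `v`-UNIT WHICH IS A LOCAL NON-NORM EXISTS AT A RAMIFIED NON-SPLIT PLACE.**  `L` CM, `L = L⁺(α)`, `α² = θ`, `ᾱ = −α`; `v` a
finite place of `L⁺` with a place `w ∣ v` of `L` fixed by complex conjugation (non-split) and `v` RAMIFIED in `L`; `c ∈ L⁺ˣ` a local non-norm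
(`(θ, c)_v = −1`).  Then there is `a ∈ L⁺` with `ord_v a = 0` and `(θ, a)_v = −1`: `a = c · N_{L∕L⁺}(π^{ord_v c})` for a `w`-uniformiser `π`
(`ord_v N(π) = 1` since `f(w∣v) = 1`; norms are local norms).  (False at unramified places: ★ `hilbertSymbol_unit_eq_one_of_isUnramifiedIn`.)
[cite: Omeara1963, §63C (63:16), §65A] [cite: NeukirchANT1999, Ch. V §1 (1.2)] [cite: CasselsFrohlichANT1967, Ch. VII Prop. 1.2] -/
theorem exists_unit_hilbertSymbol_neg_of_ramified {α : L} (hα : IsCMField.complexConj L α = -α) (hα0 : α ≠ 0) {θ : maximalRealSubfield L}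
    (hθ : α ^ 2 = algebraMap (maximalRealSubfield L) L θ) {v : HeightOneSpectrum (𝓞 (maximalRealSubfield L))}
    (w : Literature.NumberTheory.Automorphic.UnitaryGroup.PlacesOver L v) (hw : IsCMField.complexConj L • w.1 = w.1)
    (hram : ¬ Algebra.IsUnramifiedIn (𝓞 L) v.asIdeal) {c : maximalRealSubfield L} (hc0 : c ≠ 0)
    (hc : hilbertSymbol (v.adicCompletion (maximalRealSubfield L)) (algebraMap _ (v.adicCompletion (maximalRealSubfield L)) θ)
      (algebraMap _ (v.adicCompletion (maximalRealSubfield L)) c) = -1) :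
    ∃ a : maximalRealSubfield L, v.valuation (maximalRealSubfield L) a = 1 ∧
      hilbertSymbol (v.adicCompletion (maximalRealSubfield L)) (algebraMap _ (v.adicCompletion (maximalRealSubfield L)) θ)
        (algebraMap _ (v.adicCompletion (maximalRealSubfield L)) a) = -1 := by
  set Kv := v.adicCompletion (maximalRealSubfield L)
  haveI : CharZero Kv := charZero_of_injective_algebraMap (algebraMap (maximalRealSubfield L) Kv).injective
  haveI : NeZero (2 : Kv) := ⟨two_ne_zero⟩
  -- `w` is the only place above `v`
  have hfw : finitePlacesOver L v = {w.1} := by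
    haveI : Subsingleton (Literature.NumberTheory.Automorphic.UnitaryGroup.PlacesOver L v) :=
      Literature.NumberTheory.Automorphic.UnitaryGroup.PlacesOver.subsingleton_of_smul_eq
        (IsCMField.complexConj L) (IsCMField.complexConj_ne_one L) w hw
    refine Set.eq_singleton_iff_unique_mem.2 ⟨w.2, fun w' hw' => ?_⟩
    exact congrArg Subtype.val (Subsingleton.elim (⟨w', hw'⟩ : Literature.NumberTheory.Automorphic.UnitaryGroup.PlacesOver L v) w)
  have hθ0 : (θ : maximalRealSubfield L) ≠ 0 := fun h => by
    rw [h, map_zero, sq_eq_zero_iff] at hθ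
    exact hα0 hθ
  -- a `w`-uniformiser `π`; its norm is a `v`-uniformiser
  obtain ⟨π, hπ⟩ := w.1.valuation_exists_uniformizer L
  have hπ0 : π ≠ 0 := by
    rintro rfl
    rw [map_zero] at hπ
    exact WithZero.zero_ne_coe hπ
  -- the exponent and the correcting norm `n = N(π^m)`
  set m : ℤ := WithZero.log (v.valuation (maximalRealSubfield L) c) with hm
  set zu : Lˣ := Units.mk0 π hπ0 ^ m with hzu
  set n : maximalRealSubfield L := Algebra.norm (maximalRealSubfield L) (zu : L) with hn
  have hn0 : n ≠ 0 := Algebra.norm_ne_zero_iff.2 zu.ne_zero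
  have hvn0 : v.valuation (maximalRealSubfield L) n ≠ 0 := (Valuation.ne_zero_iff _).2 hn0
  have hlog : WithZero.log (v.valuation (maximalRealSubfield L) n) = -m := by
    rw [hn, log_valuation_norm_eq_of_not_isUnramifiedIn hram hfw zu, hzu, Units.val_zpow_eq_zpow_val, Units.val_mk0, map_zpow₀, hπ,
      WithZero.log_zpow, WithZero.log_exp, smul_eq_mul, mul_neg, mul_one]
  have hvn : v.valuation (maximalRealSubfield L) n = WithZero.exp (-m) := by
    rw [← WithZero.exp_log hvn0, hlog]
  refine ⟨c * n, ?_, ?_⟩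
  · have hvc : v.valuation (maximalRealSubfield L) c = WithZero.exp m := by
      rw [hm, WithZero.exp_log ((Valuation.ne_zero_iff _).2 hc0)]
    rw [map_mul, hvc, hvn, ← WithZero.exp_add, add_neg_cancel, WithZero.exp_zero]
  · -- `c ∉ N(L_wˣ)`, `n = x² − θy² ∈ N(L_wˣ)`, hence `c·n ∉ N(L_wˣ)`
    obtain ⟨x, y, hxy⟩ := IsCMField.exists_eq_add_mul hα hα0 (zu : L)
    have hN : n = x ^ 2 - θ * y ^ 2 := by
      apply (algebraMap (maximalRealSubfield L) L).injective
      rw [hn, algebraMap_norm_eq_mul_complexConj, hxy, IsCMField.add_mul_mul_complexConj_add_mul hα hθ]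
    have hθK0 : algebraMap _ Kv θ ≠ 0 := (map_ne_zero _).2 hθ0
    have hcK0 : algebraMap _ Kv c ≠ 0 := (map_ne_zero _).2 hc0
    have hnK0 : algebraMap _ Kv n ≠ 0 := (map_ne_zero _).2 hn0
    have hcN : Units.mk0 _ hcK0 ∉ quadraticNormSubgroup Kv (algebraMap _ Kv θ) := by
      rw [← hilbertSymbol_eq_neg_one_iff_not_mem_quadraticNormSubgroup hθK0, Units.val_mk0, hilbertSymbol_comm]
      exact hc
    have hnN : Units.mk0 _ hnK0 ∈ quadraticNormSubgroup Kv (algebraMap _ Kv θ) :=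
      ⟨algebraMap _ Kv x, algebraMap _ Kv y, by rw [Units.val_mk0, hN, map_sub, map_mul, map_pow, map_pow]⟩
    have hcnN : Units.mk0 _ hcK0 * Units.mk0 _ hnK0 ∉ quadraticNormSubgroup Kv (algebraMap _ Kv θ) := fun h =>
      hcN (by simpa only [mul_inv_cancel_right] using Subgroup.mul_mem _ h (Subgroup.inv_mem _ hnN))
    have h := (hilbertSymbol_eq_neg_one_iff_not_mem_quadraticNormSubgroup hθK0 _).2 hcnN
    rw [Units.val_mul, Units.val_mk0, Units.val_mk0, hilbertSymbol_comm] at h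
    rwa [map_mul]

end CM

/-! ## §3 The same in the letters of ★ `K2LiuLocalSWRamifiedRankOneSign`: `‖ι_w(a)‖_w = 1` and `θ = δ²` -/

section Letters

open Literature.NumberTheory.Automorphic Literature.NumberTheory.Automorphic.UnitaryGroup Literature.NumberTheory.GelbartRogawski1991.UnitaryDualPair

variable {L : Type} [Field L] [NumberField L] [IsCMField L]

omit [IsCMField L] in
/-- `|a|_v = 1 ⇒ ‖ι_w(a)‖_w = 1` (`ι_w : L⁺_v → L_w`; `v_w ∘ ι_w = v_v^{e}`, and Mathlib's norm on `L_w` is the rank-one norm of `v_w`). [folklore] -/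
theorem norm_toPlace_eq_one_of_valuation_eq_one {v : HeightOneSpectrum (𝓞 (maximalRealSubfield L))} (w : UnitaryGroup.PlacesOver L v)
    {a : maximalRealSubfield L} (ha : v.valuation (maximalRealSubfield L) a = 1) :
    ‖toPlace v w ((a : maximalRealSubfield L) : v.adicCompletion (maximalRealSubfield L))‖ = 1 := by
  have h : Valued.v (toPlace v w ((a : maximalRealSubfield L) : v.adicCompletion (maximalRealSubfield L))) = 1 := by
    rw [valued_toPlace, IsDedekindDomain.HeightOneSpectrum.valuedAdicCompletion_eq_valuation', ha, one_pow]
  exact le_antisymm (Valued.toNormedField.norm_le_one_iff.2 h.le) (Valued.toNormedField.one_le_norm_iff.2 h.ge)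

/-- **(q4′) IN THE LETTERS OF FILE F7r**: at a ramified non-split `v`, from any `c ∈ L⁺ˣ` with `(δ², c)_v = −1` one gets `a ∈ L⁺` with
`‖ι_{w}(a)‖_{w} = 1` and `(δ², a)_v = −1` — exactly the hypotheses `ha₁`, `ha` of ★ `K2LiuLocalSWRamifiedRankOneSign.localSiegelCharacter_eq_neg_one_of_detDelta`
∕ `sum_weylDelta_witness_eq_two_mul` (`δ = imagUnit L`, `δ² = imagUnitSq L`). [cite: Omeara1963, §63C (63:16), §65A] [cite: NeukirchANT1999, Ch. V §1 (1.2)] -/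
theorem exists_norm_toPlace_eq_one_hilbertSymbol_neg_of_ramified {v : HeightOneSpectrum (𝓞 (maximalRealSubfield L))}
    (w : UnitaryGroup.PlacesOver L v) (hw : IsCMField.complexConj L • w.1 = w.1) (hram : ¬ Algebra.IsUnramifiedIn (𝓞 L) v.asIdeal)
    {c : maximalRealSubfield L} (hc0 : c ≠ 0)
    (hc : hilbertSymbol (v.adicCompletion (maximalRealSubfield L))
      ((imagUnitSq L : maximalRealSubfield L) : v.adicCompletion (maximalRealSubfield L)) ((c : maximalRealSubfield L) : v.adicCompletion (maximalRealSubfield L)) = -1) :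
    ∃ a : maximalRealSubfield L, ‖toPlace v w ((a : maximalRealSubfield L) : v.adicCompletion (maximalRealSubfield L))‖ = 1 ∧
      hilbertSymbol (v.adicCompletion (maximalRealSubfield L)) ((imagUnitSq L : maximalRealSubfield L) : v.adicCompletion (maximalRealSubfield L))
        ((a : maximalRealSubfield L) : v.adicCompletion (maximalRealSubfield L)) = -1 := by
  obtain ⟨a, ha, hsa⟩ := exists_unit_hilbertSymbol_neg_of_ramified (complexConj_imagUnit L) (imagUnit_ne_zero L)
    (by rw [sq]; exact imagUnit_mul_self L) w hw hram hc0 hc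
  exact ⟨a, norm_toPlace_eq_one_of_valuation_eq_one w ha, hsa⟩

end Letters

end Summit.HodgeConjecture.HodgeConjecture.Cruxes.HLiu418.K2LiuRamifiedUnitNonNorm
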